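import Summits.QuantumFields.YangMills.Theorems.BalabanUVNodesPortU8LocUnivDecay
import Summits.QuantumFields.YangMills.Theorems.UnitScaleTiltProp8FlatHCurlCurlWhole

/-!
# Port piece U8 — (D1) CLAUSE 4 ROAD, STEP 1: the whole-torus window response IS `GQ*(QGQ*)⁻¹` of r03's two-scale family `twoScale (k+1) ∅`,
# hence [15] (137) ★★ `curlCurl_windowResp_univ`: `∂*∂(windowResp univ l) = Q*((QGQ*)⁻¹e_l) − a·Q*e_l` in r03's letters — the form to which r03's PROVED
# [B6] (2.148)∕(2.150) kernel rows (`B6Cor28TwoScaleV1.blockBound_QsRinv_scaling`, `blockBound_Q_adjoint`, general `d`) apply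

Cell `ym-nodeO-ideate` ∕ `ym-balaban-port`, porter `ymgap-nodeO-port-PTB-1` (gen 4).  JOIN-side helper for **stmt-QuantumFields-27238** (K0ᴬ), `--supports … --as helper`.
The UnitScaleTilt lineage (`ym3-torus-p1` g16, ✓`FlatHCurlCurlWhole.hKernelRow3_whole`, 𝕋³) did this row for its flat `H` at `d + 1 = 3`; THIS FILE is the same road at `d + 1 = 4`
for DEF-1's `windowResp … Finset.univ` (the selector-free transverse response), over r03's GENERAL-`d` engine `B6Cor28TwoScaleV1.blockBound_QsRinv_scaling` ∕ `blockBound_Q_adjoint`.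
[15] = [Balaban1985Variational], [B5] = [Balaban1984PropagatorsI], [B6] = [Balaban1984PropagatorsII].

WHAT IS PROVED (kernel, sorry-free; `hk2 : k + 2 ≤ m + K` — one spare level above `k + 1`, automatic at the port's `K = recordK₀ F Mc k + n ≥ k + 1 + n`, `m ≥ 1`).
§1 ★ `toLp_windowResp_univ_eq_hOp_twoScale` — `toLp (windowResp F k K univ l) = hOp (GE (twoScale (k+1) hk2 ∅) …) (QsE _) (EE …) e_{ι l}` for EVERY positive weight: both are
   the tower transport of `H_{k+1}` of (1.63) on the indicator datum (✓`tVE_windowResp_univ` + ✓`FlatHCurlCurlWhole.toLp_H_eq_hOp_twoScale_empty`).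
§2 ★★ `curlCurl_windowResp_univ` — [15] (137) in r03's letters: `∂*_c∂_c(windowResp univ l) = Q*((QGQ*)⁻¹e_{ι l}) − a·Q*(e_{ι l})`, `c = L^{k+1}`, `a = (L^{k+1})⁴`
   (✓`FlatHCurlCurl.curlCurl_hOp` + ✓`B6Eq235TwoScaleV1.QsE_eq`∕`EE_eq`∕`reindex_symm_single`).
NEXT (not in this file): the kernel row `|(∂*₁∂₁ windowResp univ l)(b)| ≤ C·η²·e^{−δ·|block(b₋) − l₂|_{T,∞}}` from §2 by r03's (2.148)∘`Q*` row `B6Cor28TwoScaleV1.blockBound_QsRinv_scaling 3 F.L …`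
   (window `a₀ = a₁ = 1`) + the `Q*` row `blockBound_Q_adjoint` (volume factor `η⁴` cancelled by `a`) + `∂*_c∂_c = c²·∂*₁∂₁` (`B8Eq155AbelianMultiLevelTorus.hodge_apply_eq_sq_mul`) — typed in the
   porter's work folder; the remaining obstruction is clerical (r03's rows are stated over the literal record `⟨3+1, L, m, K, _, _⟩` with the classical `DecidableEq` inside
   `EuclideanSpace.single`; the transport to `F.P K` is done, the instance normalisation is not).

HONEST FRAMING.  Bookkeeping over PROVED tree theorems (r03's [B6] Sect. C two-scale layer, p1 g14∕g16's bridge, DEF-1∕PTZ-1's window currency); this is the `d*d` face of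
(‴-LocUniv) for the scalar response — the token-letter clause 4 (matrix entries, `η³`, `tdist`) is the next file; clause 3 (the Laplacian face = (137) + (140) `∂∂*H`) is NOT
touched; nothing of Bałaban's renormalization-group analysis asserted; K0ᴬ 27238 OPEN; NODE O 0∕1; COUNT 8∕28 · K 1∕4 UNMOVED; finite `𝕋⁴_{L^K}` at fixed ε — NOT continuum ∕ OS ∕
Clay; **the Yang–Mills mass gap (Clay) is NOT proved by any of this.**
-/

noncomputable section

open scoped BigOperators InnerProductSpace Matrix

namespace Summit.QuantumFields.YangMills.Theorems.PortU8

open Literature.MathematicalPhysics.QuantumFieldTheory.Balaban1983to89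
open Literature.MathematicalPhysics.QuantumFieldTheory.Balaban1983to89.Node00
open Literature.MathematicalPhysics.QuantumFieldTheory.Balaban1983to89.T4Continuum (T4Family)
open Literature.MathematicalPhysics.QuantumFieldTheory.Balaban1983to89.B6SectADomainsV1 (Domains)
open Literature.MathematicalPhysics.QuantumFieldTheory.BalabanImbrieJaffe1984to88.BIJ85AxialPropagator411 (BondSpace)
open Literature.MathematicalPhysics.QuantumFieldTheory.Balaban1983to89.B6SectAOperatorsV1 (BondIdx BondIdxSpace QE QsE aE dsE dcE dcsE RE QE_apply aE_apply)
open Literature.MathematicalPhysics.QuantumFieldTheory.Balaban1983to89.B6SectAVectorModelV1 (GE EE)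
open Literature.MathematicalPhysics.QuantumFieldTheory.Balaban1983to89.B6SectA (hOp)
open Literature.MathematicalPhysics.QuantumFieldTheory.Balaban1983to89.B6SectCTwoScaleV1 (twoScale CIdx OutBond InBond wPrinted)
open Literature.MathematicalPhysics.QuantumFieldTheory.Balaban1983to89.B6SectCTwoScaleV1Lattice (tsV1)
open Literature.MathematicalPhysics.QuantumFieldTheory.Balaban1983to89.B6Eq2129TwoScaleV1 (toBondIdx toBondIdx_bijective wLevel wLevel_pos)
open Literature.MathematicalPhysics.QuantumFieldTheory.Balaban1983to89.B6Eq2143TwoScaleV1 (QGQs)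
open Literature.MathematicalPhysics.QuantumFieldTheory.Balaban1983to89.B6Eq235TwoScaleV1 (reindex)
open Literature.MathematicalPhysics.QuantumFieldTheory.Balaban1983to89.B5Eq117TorusCarriers (Mk tV tB)
open Literature.MathematicalPhysics.QuantumFieldTheory.Balaban1983to89.B5Eq118OneStroke (iterBlockOf)
open Literature.MathematicalPhysics.QuantumFieldTheory.Balaban1983to89.B5Prop12FieldsLattice (distSite)
open Literature.MathematicalPhysics.QuantumFieldTheory.Balaban1983to89.B5TowerOneStroke (pullR)
open Literature.MathematicalPhysics.QuantumFieldTheory.Balaban1983to89.B5Hk163Torus (HkOp)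
open Literature.MathematicalPhysics.QuantumFieldTheory.Balaban1983to89.B5HkOpLandauMin (hkT hkT_def)
open Literature.MathematicalPhysics.QuantumFieldTheory.Balaban1983to89.B5Eq147TorusBridge (tVE tVE_symm_eq)
open Literature.MathematicalPhysics.QuantumFieldTheory.Balaban1983to89.B4TorusKernel.MultiPeriod (torusSupNorm)
open Literature.MathematicalPhysics.QuantumFieldTheory.Balaban1983to89.B6LowerBound2153Torus (rep)
open Summit.QuantumFields.YangMills.Theorems.K0RecordFormatNames
open Summit.QuantumFields.YangMills.Theorems.FlatDomainsCongr (lamBond_twoScale_empty_iff)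
open Summit.QuantumFields.YangMills.Theorems.FlatHCurlCurlWhole (toLp_H_eq_hOp_twoScale_empty)

variable (F : T4Family) {k K : ℕ}


/-! ## §1  The whole-torus window response is `hOp` of r03's `twoScale (k+1) ∅` -/

open Classical in
/-- ★ **`windowResp univ l` IS `GQ*(QGQ*)⁻¹e_{ι l}` OF r03's TWO-SCALE FAMILY `twoScale (k+1) ∅`** (any positive weights): both sides are the tower transport of Bałaban's
`H_{k+1}` of (1.63) applied to the indicator datum of the unit-lattice bond `⟨l₂, l₁⟩`. [cite: Balaban1984PropagatorsI, (1.63) p.28; Balaban1984PropagatorsII, (2.35) p.228, (2.97) p.240] -/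
theorem toLp_windowResp_univ_eq_hOp_twoScale (hk2 : k + 1 + 1 ≤ (F.P K).m + (F.P K).K) (hc : (((F.P K).L : ℝ) ^ (k + 1)) ≠ 0)
    {w : BondIdx (twoScale (k + 1) hk2 (∅ : Finset (Site (F.P K) (k + 1 + 1)))) → ℝ} (hw : ∀ i, 0 < w i) (l : RespLabel F k K) :
    WithLp.toLp 2 (windowResp F k K Finset.univ l) =
      hOp (GE (twoScale (k + 1) hk2 (∅ : Finset (Site (F.P K) (k + 1 + 1)))) hc hw) (QsE _)
        (EE (twoScale (k + 1) hk2 (∅ : Finset (Site (F.P K) (k + 1 + 1)))) hc hw)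
        (EuclideanSpace.single (toBondIdx hk2 (∅ : Finset (Site (F.P K) (k + 1 + 1)))
            (Sum.inl ⟨⟨l.2, l.1⟩, Finset.notMem_empty _, Finset.notMem_empty _⟩)) (1 : ℝ)) := by
  have hk : k + 1 ≤ (F.P K).m + (F.P K).K := Nat.le_of_succ_le hk2
  have hjlt : k + 1 < (twoScale (k + 1) hk2 (∅ : Finset (Site (F.P K) (k + 1 + 1)))).k + 1 := by
    show k + 1 < k + 1 + 1 + 1; omega
  -- the level-`(k+1)` reading of `e_{ι l}` is the indicator of `⟨l₂, l₁⟩`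
  have hread : (fun cb' : PBond (F.P K) (k + 1) =>
        (EuclideanSpace.single (toBondIdx hk2 (∅ : Finset (Site (F.P K) (k + 1 + 1)))
            (Sum.inl ⟨⟨l.2, l.1⟩, Finset.notMem_empty _, Finset.notMem_empty _⟩)) (1 : ℝ) :
          BondIdxSpace (twoScale (k + 1) hk2 (∅ : Finset (Site (F.P K) (k + 1 + 1)))))
          ⟨⟨⟨k + 1, hjlt⟩, cb'⟩, (lamBond_twoScale_empty_iff hk2 (k + 1) cb').2 rfl⟩) =
      fun cb' : PBond (F.P K) (k + 1) => if cb' = ⟨l.2, l.1⟩ then (1 : ℝ) else 0 := by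
    funext cb'
    rw [PiLp.single_apply]
    by_cases h : cb' = ⟨l.2, l.1⟩
    · subst h
      have hcond : (⟨⟨⟨k + 1, hjlt⟩, (⟨l.2, l.1⟩ : PBond (F.P K) (k + 1))⟩, (lamBond_twoScale_empty_iff hk2 (k + 1) ⟨l.2, l.1⟩).2 rfl⟩ :
          BondIdx (twoScale (k + 1) hk2 (∅ : Finset (Site (F.P K) (k + 1 + 1))))) =
          toBondIdx hk2 (∅ : Finset (Site (F.P K) (k + 1 + 1))) (Sum.inl ⟨⟨l.2, l.1⟩, Finset.notMem_empty _, Finset.notMem_empty _⟩) := rfl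
      rw [if_pos hcond, if_pos rfl]
    · rw [if_neg, if_neg h]
      intro heq
      apply h
      have := congrArg (fun i : BondIdx (twoScale (k + 1) hk2 (∅ : Finset (Site (F.P K) (k + 1 + 1)))) => i.1) heq
      simpa [toBondIdx] using this
  have h1 := toLp_H_eq_hOp_twoScale_empty (P := F.P K) hk2 hc hw
    (fun p => (EuclideanSpace.single (toBondIdx hk2 (∅ : Finset (Site (F.P K) (k + 1 + 1)))
        (Sum.inl ⟨⟨l.2, l.1⟩, Finset.notMem_empty _, Finset.notMem_empty _⟩)) (1 : ℝ) :
      BondIdxSpace (twoScale (k + 1) hk2 (∅ : Finset (Site (F.P K) (k + 1 + 1))))) p)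
  rw [hread] at h1
  have h2 : WithLp.toLp 2 (fun p => (EuclideanSpace.single (toBondIdx hk2 (∅ : Finset (Site (F.P K) (k + 1 + 1)))
        (Sum.inl ⟨⟨l.2, l.1⟩, Finset.notMem_empty _, Finset.notMem_empty _⟩)) (1 : ℝ) :
      BondIdxSpace (twoScale (k + 1) hk2 (∅ : Finset (Site (F.P K) (k + 1 + 1))))) p) =
      EuclideanSpace.single (toBondIdx hk2 (∅ : Finset (Site (F.P K) (k + 1 + 1)))
        (Sum.inl ⟨⟨l.2, l.1⟩, Finset.notMem_empty _, Finset.notMem_empty _⟩)) (1 : ℝ) := by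
    ext p; rfl
  rw [h2] at h1
  refine Eq.trans ?_ h1
  -- our side: `toLp (windowResp univ l) = tVE⁻¹ (hkT … (tB 𝟙)) = toLp (tV⁻¹ (pullR … (H_{k+1} ·ᵥ cplx (tB 𝟙))))`
  have h3 : WithLp.toLp 2 (windowResp F k K Finset.univ l) =
      (tVE (F.P K) hk).symm (hkT (F.P K).L (Mk (F.P K) (k + 1)) (k + 1) (tB fun c : PBond (F.P K) (k + 1) => if c = ⟨l.2, l.1⟩ then (1 : ℝ) else 0)) := by
    rw [← tVE_windowResp_univ F hk l, LinearIsometryEquiv.symm_apply_apply]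
  rw [h3, tVE_symm_eq, hkT_def]

/-! ## §2  [15] (137) for the window response, in r03's two-scale letters -/

open Classical in
/-- ★★ **`∂*∂(windowResp univ l) = Q*((QGQ*)⁻¹e_{ι l}) − a·Q*(e_{ι l})`** with r03's `Q = (tsV1 …).Q`, `(QGQ*)⁻¹ = Ring.inverse QGQs`, at the lattice factor `c = L^{k+1}` and the
weight `a = (L^{k+1})⁴` — [15] (137) ∕ [B6] (2.19)+(2.35) (✓`FlatHCurlCurl.curlCurl_hOp`) for `hOp` of `twoScale (k+1) ∅` (§1) and r03's reindexing
(✓`B6Eq235TwoScaleV1.QsE_eq`∕`EE_eq`∕`reindex_symm_single`). [cite: Balaban1985Variational, (137) p.298; Balaban1984PropagatorsII, (2.19) p.226, (2.35) p.228, (2.97) p.240] -/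
theorem curlCurl_windowResp_univ (hk2 : k + 1 + 1 ≤ (F.P K).m + (F.P K).K) (l : RespLabel F k K) :
    dcsE (((F.P K).L : ℝ) ^ (k + 1)) (dcE (((F.P K).L : ℝ) ^ (k + 1)) (WithLp.toLp 2 (windowResp F k K Finset.univ l))) =
      (LinearMap.adjoint (tsV1 (P := F.P K) (c := ((F.P K).L : ℝ) ^ (k + 1)) (pow_ne_zero _ (Nat.cast_ne_zero.2 (F.P K).L_pos.ne'))
            (∅ : Finset (Site (F.P K) (k + 1 + 1))) (wPrinted (F.P K) (k + 1) ∅ ((((F.P K).L : ℝ) ^ (k + 1)) ^ 4))).Q ∘ₗ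
        Ring.inverse (QGQs (P := F.P K) (c := ((F.P K).L : ℝ) ^ (k + 1)) (pow_ne_zero _ (Nat.cast_ne_zero.2 (F.P K).L_pos.ne'))
          (∅ : Finset (Site (F.P K) (k + 1 + 1))) (w := wPrinted (F.P K) (k + 1) ∅ ((((F.P K).L : ℝ) ^ (k + 1)) ^ 4))))
        (EuclideanSpace.single (Sum.inl ⟨⟨l.2, l.1⟩, Finset.notMem_empty _, Finset.notMem_empty _⟩) (1 : ℝ)) -
      ((((F.P K).L : ℝ) ^ (k + 1)) ^ 4) •
        LinearMap.adjoint (tsV1 (P := F.P K) (c := ((F.P K).L : ℝ) ^ (k + 1)) (pow_ne_zero _ (Nat.cast_ne_zero.2 (F.P K).L_pos.ne'))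
            (∅ : Finset (Site (F.P K) (k + 1 + 1))) (wPrinted (F.P K) (k + 1) ∅ ((((F.P K).L : ℝ) ^ (k + 1)) ^ 4))).Q
          (EuclideanSpace.single (Sum.inl ⟨⟨l.2, l.1⟩, Finset.notMem_empty _, Finset.notMem_empty _⟩) (1 : ℝ)) := by
  have hc : (((F.P K).L : ℝ) ^ (k + 1)) ≠ 0 := pow_ne_zero _ (Nat.cast_ne_zero.2 (F.P K).L_pos.ne')
  have ha : (0 : ℝ) < (((F.P K).L : ℝ) ^ (k + 1)) ^ 4 := by
    have : (0 : ℝ) < ((F.P K).L : ℝ) := Nat.cast_pos.2 (F.P K).L_pos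
    positivity
  rw [toLp_windowResp_univ_eq_hOp_twoScale F hk2 hc (w := wLevel (F.P K) (k + 1) ((((F.P K).L : ℝ) ^ (k + 1)) ^ 4)) (wLevel_pos (j := k + 1) ha) l,
    FlatHCurlCurl.curlCurl_hOp _ hc (wLevel_pos (j := k + 1) ha),
    B6Eq235TwoScaleV1.QsE_eq hc hk2 (∅ : Finset (Site (F.P K) (k + 1 + 1))) (w := wPrinted (F.P K) (k + 1) ∅ ((((F.P K).L : ℝ) ^ (k + 1)) ^ 4)),
    B6Eq235TwoScaleV1.EE_eq hc hk2 (∅ : Finset (Site (F.P K) (k + 1 + 1))) ha]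
  have hsym : (Equiv.ofBijective (toBondIdx hk2 (∅ : Finset (Site (F.P K) (k + 1 + 1)))) (toBondIdx_bijective hk2 ∅)).symm
      (toBondIdx hk2 (∅ : Finset (Site (F.P K) (k + 1 + 1))) (Sum.inl ⟨⟨l.2, l.1⟩, Finset.notMem_empty _, Finset.notMem_empty _⟩)) =
      Sum.inl ⟨⟨l.2, l.1⟩, Finset.notMem_empty _, Finset.notMem_empty _⟩ :=
    Equiv.ofBijective_symm_apply_apply _ (toBondIdx_bijective hk2 ∅) _
  have haE : aE (twoScale (k + 1) hk2 (∅ : Finset (Site (F.P K) (k + 1 + 1)))) (wLevel (F.P K) (k + 1) ((((F.P K).L : ℝ) ^ (k + 1)) ^ 4))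
      (EuclideanSpace.single (toBondIdx hk2 (∅ : Finset (Site (F.P K) (k + 1 + 1)))
        (Sum.inl ⟨⟨l.2, l.1⟩, Finset.notMem_empty _, Finset.notMem_empty _⟩)) (1 : ℝ)) =
      ((((F.P K).L : ℝ) ^ (k + 1)) ^ 4) • EuclideanSpace.single (toBondIdx hk2 (∅ : Finset (Site (F.P K) (k + 1 + 1)))
        (Sum.inl ⟨⟨l.2, l.1⟩, Finset.notMem_empty _, Finset.notMem_empty _⟩)) (1 : ℝ) := by
    ext p
    rw [aE_apply, PiLp.smul_apply, smul_eq_mul, PiLp.single_apply]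
    by_cases hp : p = toBondIdx hk2 (∅ : Finset (Site (F.P K) (k + 1 + 1))) (Sum.inl ⟨⟨l.2, l.1⟩, Finset.notMem_empty _, Finset.notMem_empty _⟩)
    · subst hp
      simp [wLevel, toBondIdx]
    · simp [hp]
  simp only [LinearMap.comp_apply, LinearEquiv.coe_coe, LinearIsometryEquiv.coe_toLinearEquiv, LinearIsometryEquiv.symm_apply_apply, haE,
    map_smul, B6Eq235TwoScaleV1.reindex_symm_single, hsym]

end Summit.QuantumFields.YangMills.Theorems.PortU8

end
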